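import Literature.Analysis.OperatorTheory.BorelFunctionalCalculusAtoms
import Literature.Analysis.OperatorTheory.RealIntertwineCFC
import HarnessLib

/-!
# Bounded Borel functional calculus: real-linear intertwiners, reflection, non-eigenvalues

Complements to `Literature.Analysis.OperatorTheory.BorelFunctionalCalculus` (the bounded Borel
functional calculus `f ↦ f(A) = borelCFC A hA f` of a bounded self-adjoint operator `A` on a
complex Hilbert space, Reed–Simon I, Thm. VII.2), needed by the bounded-operator approach to
Tomita–Takesaki theory of Rieffel–van Daele (Pacific J. Math. 69 (1977)):

* `realCLM_apply_borelCFC_of_intertwine` — a bounded **real**-linear `V` with `V A = B V`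
  satisfies `V u(A) = u(B) V` for every bounded Borel `u : ℝ → ℝ` (the Borel version of
  `realCLM_apply_cfc_of_intertwine`; Rieffel–van Daele use it for the real projections `P, Q`
  and for `J`, §3 p. 194: "from the fact that `JRJ = 2 − R` it follows easily that
  `J R^{it} J = (2 − R)^{−it}`");
* `conjCLM_apply_borelCFC_of_intertwine` — for a bounded **conjugate-linear** `W` with
  `W A = B W` and complex `f`: `W f(A) = f̄(B) W` (the source of the sign flip `−it` above);
* `borelCFC_reflect` — `f(c − A) = (f ∘ (c − ·))(A)` (composition with an affine reflection);
* `borelCFC_congr_off_point`, `borelCFC_congr_off_two_points` — if `a` is not an eigenvalue of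
  `A` then `f(A)` only depends on `f` off `a` (via `specMeasure_singleton_eq_zero` of
  `BorelFunctionalCalculusAtoms`; Rieffel–van Daele §3, p. 194: "both `R` and `2 − R` are
  injective … it follows that the spectral measures for `R` and `2 − R` are both concentrated on
  the open interval `(0, 2)`").

## References
* M. Reed, B. Simon, *Methods of Modern Mathematical Physics I*, Thm. VII.2. [ReedSimonI1980]
* M. A. Rieffel, A. van Daele, *A bounded operator approach to Tomita–Takesaki theory*, Pacific
  J. Math. 69 (1977) 187–221, §3. [RieffelVandaele1977]
-/

noncomputable section

open MeasureTheory Filter Complex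
open _root_.Topology
open scoped InnerProductSpace ComplexConjugate

namespace Literature.Analysis.OperatorTheory

variable {H : Type*} [NormedAddCommGroup H] [InnerProductSpace ℂ H] [CompleteSpace H]

/-! ### Small algebra of the Borel calculus -/

section Algebra

variable {A : H →L[ℂ] H} (hA : IsSelfAdjoint A)

/-- `(−f)(A) = −f(A)`. [cite: ReedSimonI1980, Thm. VII.2 (a)] -/
theorem borelCFC_neg {f : ℝ → ℂ} (hf : Measurable f) {C : ℝ} (hC : ∀ t, ‖f t‖ ≤ C) :
    borelCFC A hA (-f) = -borelCFC A hA f := by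
  have : -f = fun t => (-1 : ℂ) * f t := by ext t; simp
  rw [this, borelCFC_const_mul hA (-1) hf hC, neg_one_smul]

/-- `(c • f)(A) = c • f(A)`. [cite: ReedSimonI1980, Thm. VII.2 (a)] -/
theorem borelCFC_smul (c : ℂ) {f : ℝ → ℂ} (hf : Measurable f) {C : ℝ} (hC : ∀ t, ‖f t‖ ≤ C) :
    borelCFC A hA (c • f) = c • borelCFC A hA f :=
  borelCFC_const_mul hA c hf hC

/-- `0(A) = 0`. [cite: ReedSimonI1980, Thm. VII.2 (a)] -/
theorem borelCFC_zero : borelCFC A hA (fun _ => (0 : ℂ)) = 0 := by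
  rw [borelCFC_const hA, zero_smul]

/-- Real and imaginary parts: `f(A) = (Re f)(A) + i (Im f)(A)`. [cite: ReedSimonI1980, Thm. VII.2 (a)] -/
theorem borelCFC_eq_re_add_im {f : ℝ → ℂ} (hf : Measurable f) {C : ℝ} (hC : ∀ t, ‖f t‖ ≤ C) :
    borelCFC A hA f = borelCFC A hA (fun t => ((f t).re : ℂ)) +
      I • borelCFC A hA (fun t => ((f t).im : ℂ)) := by
  have hre : Measurable fun t => ((f t).re : ℂ) := measurable_ofReal.comp (measurable_re.comp hf)
  have him : Measurable fun t => ((f t).im : ℂ) := measurable_ofReal.comp (measurable_im.comp hf)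
  have hreC : ∀ t, ‖((f t).re : ℂ)‖ ≤ C := fun t => by
    rw [norm_real, Real.norm_eq_abs]; exact (abs_re_le_norm _).trans (hC t)
  have himC : ∀ t, ‖((f t).im : ℂ)‖ ≤ C := fun t => by
    rw [norm_real, Real.norm_eq_abs]; exact (abs_im_le_norm _).trans (hC t)
  conv_lhs => rw [fun_eq_re_add_I_im f]
  rw [borelCFC_add hA (f' := fun t => I * ((f t).im : ℂ)) hre (him.const_mul I) hreC (C' := C)
    (fun t => by rw [norm_mul, norm_I, one_mul]; exact himC t), borelCFC_const_mul hA I him himC]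

/-- Complex conjugate: `f̄(A) = (Re f)(A) − i (Im f)(A)`. [cite: ReedSimonI1980, Thm. VII.2 (a)] -/
theorem borelCFC_star_eq_re_sub_im {f : ℝ → ℂ} (hf : Measurable f) {C : ℝ}
    (hC : ∀ t, ‖f t‖ ≤ C) :
    borelCFC A hA (star f) = borelCFC A hA (fun t => ((f t).re : ℂ)) -
      I • borelCFC A hA (fun t => ((f t).im : ℂ)) := by
  have hsf : Measurable (star f) := measurable_star_fun hf
  have hsC : ∀ t, ‖(star f) t‖ ≤ C := fun t => by rw [Pi.star_apply, norm_star]; exact hC t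
  rw [borelCFC_eq_re_add_im hA hsf hsC]
  have h1 : (fun t => (((star f) t).re : ℂ)) = fun t => ((f t).re : ℂ) := by
    ext t; simp
  have h2 : (fun t => (((star f) t).im : ℂ)) = fun t => (-1 : ℂ) * ((f t).im : ℂ) := by
    ext t; simp
  have him : Measurable fun t => ((f t).im : ℂ) := measurable_ofReal.comp (measurable_im.comp hf)
  have himC : ∀ t, ‖((f t).im : ℂ)‖ ≤ C := fun t => by
    rw [norm_real, Real.norm_eq_abs]; exact (abs_im_le_norm _).trans (hC t)
  rw [h1, h2, borelCFC_const_mul hA (-1) him himC, smul_smul, mul_neg_one, neg_smul,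
    sub_eq_add_neg]

end Algebra

/-! ### Real-linear and conjugate-linear intertwiners -/

section Intertwine

/-- Real-valued, uniformly bounded continuous `L¹(μ)`-approximants of a bounded real Borel
function (real parts of the complex approximants of
`exists_seq_continuous_tendsto_integral`). [folklore] -/
theorem exists_seq_continuous_real_tendsto_integral (μ : Measure ℝ) [IsFiniteMeasure μ]
    {u : ℝ → ℝ} (hu : Measurable u) {C : ℝ} (hC : ∀ t, ‖(u t : ℂ)‖ ≤ C) :
    ∃ g : ℕ → ℝ → ℝ, (∀ n, Continuous (g n)) ∧ (∀ n t, ‖(g n t : ℂ)‖ ≤ 2 * C) ∧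
      Tendsto (fun n => ∫ t, ‖(u t : ℂ) - (g n t : ℂ)‖ ∂μ) atTop (𝓝 0) := by
  have hf : Measurable fun t => (u t : ℂ) := measurable_ofReal.comp hu
  obtain ⟨g, hgc, hgb, hg⟩ := exists_seq_continuous_tendsto_integral μ hf hC
  refine ⟨fun n t => (g n t).re, fun n => continuous_re.comp (hgc n), fun n t => ?_, ?_⟩
  · rw [norm_real, Real.norm_eq_abs]
    exact (abs_re_le_norm _).trans (hgb n t)
  · refine squeeze_zero (fun n => integral_nonneg fun t => norm_nonneg _) (fun n => ?_) hg
    have hfi : Integrable (fun t => (u t : ℂ)) μ := integrable_of_norm_le hf hC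
    have hgi : Integrable (g n) μ := integrable_of_norm_le (hgc n).measurable (hgb n)
    have hgi' : Integrable (fun t => ((g n t).re : ℂ)) μ :=
      integrable_of_norm_le (measurable_ofReal.comp (measurable_re.comp (hgc n).measurable))
        (C := 2 * C) fun t => by
          rw [norm_real, Real.norm_eq_abs]; exact (abs_re_le_norm _).trans (hgb n t)
    refine integral_mono (hfi.sub hgi').norm (hfi.sub hgi).norm fun t => ?_
    have e : (u t : ℂ) - ((g n t).re : ℂ) = ((((u t : ℂ) - g n t).re : ℝ) : ℂ) := by simp
    change ‖(u t : ℂ) - ((g n t).re : ℂ)‖ ≤ ‖(u t : ℂ) - g n t‖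
    rw [e, norm_real, Real.norm_eq_abs]
    exact abs_re_le_norm _

/-- **Real-linear intertwiners pass through the bounded Borel functional calculus**: if
`V (A ψ) = B (V ψ)` with `A`, `B` bounded self-adjoint and `V` bounded real-linear, then
`V (u(A) ψ) = u(B) (V ψ)` for every bounded Borel `u : ℝ → ℝ`. (Continuous `u`:
`realCLM_apply_cfc_of_intertwine`; the passage to Borel `u` is Reed–Simon Thm. VII.2 (d),
approximating `u` in `L¹(μ^A_ψ + μ^B_{Vψ})`.) Rieffel–van Daele use this for `P`, `Q`, `J`.
[cite: RieffelVandaele1977, Prop. 3.3 and §3 p. 194] -/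
theorem realCLM_apply_borelCFC_of_intertwine (V : H →L[ℝ] H) {A B : H →L[ℂ] H}
    (hA : IsSelfAdjoint A) (hB : IsSelfAdjoint B) (hV : ∀ ψ, V (A ψ) = B (V ψ))
    {u : ℝ → ℝ} (hu : Measurable u) {C : ℝ} (hC : ∀ t, ‖(u t : ℂ)‖ ≤ C) (ψ : H) :
    V (borelCFC A hA (fun t => (u t : ℂ)) ψ) = borelCFC B hB (fun t => (u t : ℂ)) (V ψ) := by
  set ν := specMeasure A hA ψ + specMeasure B hB (V ψ)
  have hf : Measurable (fun t => (u t : ℂ)) := measurable_ofReal.comp hu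
  obtain ⟨g, hgc, hgb, hg⟩ := exists_seq_continuous_real_tendsto_integral ν hu hC
  have h1 := tendsto_cfcC_borelCFC_of_le hA hf hC ψ (Measure.le_add_right le_rfl)
    (g := fun n t => (g n t : ℂ)) (fun n => continuous_ofReal.comp (hgc n)) hgb hg
  have h2 := tendsto_cfcC_borelCFC_of_le hB hf hC (V ψ) (Measure.le_add_left le_rfl)
    (g := fun n t => (g n t : ℂ)) (fun n => continuous_ofReal.comp (hgc n)) hgb hg
  have h1V : Tendsto (fun n => V (cfcC A (fun t => (g n t : ℂ)) ψ)) atTop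
      (𝓝 (V (borelCFC A hA (fun t => (u t : ℂ)) ψ))) :=
    V.continuous.continuousAt.tendsto.comp h1
  have heq : (fun n => V (cfcC A (fun t => (g n t : ℂ)) ψ)) =
      fun n => cfcC B (fun t => (g n t : ℂ)) (V ψ) := by
    ext n
    rw [cfcC_ofReal hA, cfcC_ofReal hB, realCLM_apply_cfc_of_intertwine V hA hB hV (hgc n) ψ]
  rw [heq] at h1V
  exact tendsto_nhds_unique h1V h2

/-- **Conjugate-linear intertwiners conjugate the symbol**: if `W (A ψ) = B (W ψ)` with `W`
bounded conjugate-linear, then `W (f(A) ψ) = f̄(B) (W ψ)` for every bounded Borel `f : ℝ → ℂ`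
(Rieffel–van Daele §3, p. 194: "`J R^{it} J = (2 − R)^{−it}` … the minus sign in the exponent …
is caused by the conjugate linearity of `J`"). [cite: RieffelVandaele1977, §3 p. 194] -/
theorem conjCLM_apply_borelCFC_of_intertwine (W : H →L⋆[ℂ] H) {A B : H →L[ℂ] H}
    (hA : IsSelfAdjoint A) (hB : IsSelfAdjoint B) (hW : ∀ ψ, W (A ψ) = B (W ψ))
    {f : ℝ → ℂ} (hf : Measurable f) {C : ℝ} (hC : ∀ t, ‖f t‖ ≤ C) (ψ : H) :
    W (borelCFC A hA f ψ) = borelCFC B hB (star f) (W ψ) := by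
  -- the underlying real-linear map
  let V : H →L[ℝ] H :=
    { toFun := W
      map_add' := map_add W
      map_smul' := fun r x => by
        rw [← Complex.coe_smul, map_smulₛₗ W, RingHom.id_apply, starRingEnd_apply, star_def,
          conj_ofReal, Complex.coe_smul]
      cont := W.continuous }
  have hV : ∀ ψ, V (A ψ) = B (V ψ) := hW
  have hreC : ∀ t, ‖((f t).re : ℂ)‖ ≤ C := fun t => by
    rw [norm_real, Real.norm_eq_abs]; exact (abs_re_le_norm _).trans (hC t)
  have himC : ∀ t, ‖((f t).im : ℂ)‖ ≤ C := fun t => by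
    rw [norm_real, Real.norm_eq_abs]; exact (abs_im_le_norm _).trans (hC t)
  have h1 := realCLM_apply_borelCFC_of_intertwine V hA hB hV
    (u := fun t => (f t).re) (measurable_re.comp hf) hreC ψ
  have h2 := realCLM_apply_borelCFC_of_intertwine V hA hB hV
    (u := fun t => (f t).im) (measurable_im.comp hf) himC ψ
  change W _ = borelCFC B hB _ (W ψ) at h1 h2
  rw [borelCFC_eq_re_add_im hA hf hC, borelCFC_star_eq_re_sub_im hB hf hC,
    add_apply, smul_apply, map_add,
    map_smulₛₗ W, h1, h2, sub_apply, smul_apply, starRingEnd_apply, star_def, conj_I, neg_smul, sub_eq_add_neg]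

/-- **Reflection**: for `A' = c − A` one has `f(A') = (f ∘ (c − ·))(A)` for every bounded Borel
`f` (the continuous case is composition in the continuous functional calculus; the Borel case
follows by approximating `f` in `L¹(μ^{A'}_ψ + (c − ·)_* μ^A_ψ)`). Used with `c = 2` for
Rieffel–van Daele's `2 − R`. [folklore] -/
theorem borelCFC_reflect {A A' : H →L[ℂ] H} (hA : IsSelfAdjoint A) (hA' : IsSelfAdjoint A')
    (c : ℝ) (h : ∀ ψ, A' ψ = (c : ℂ) • ψ - A ψ) {f : ℝ → ℂ} (hf : Measurable f) {C : ℝ}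
    (hC : ∀ t, ‖f t‖ ≤ C) :
    borelCFC A' hA' f = borelCFC A hA (fun t => f (c - t)) := by
  have hA'eq : A' = algebraMap ℂ (H →L[ℂ] H) c - A := by
    ext ψ
    rw [h ψ, sub_apply, Algebra.algebraMap_eq_smul_one,
      smul_apply, one_apply_eq_self]
  -- the continuous case
  have hcont : ∀ {g : ℝ → ℂ}, Continuous g → cfcC A' g = cfcC A (fun t => g (c - t)) := by
    intro g hg
    have := hA.isStarNormal
    have e1 : cfc (fun z : ℂ => (c : ℂ) - z) A = algebraMap ℂ (H →L[ℂ] H) c - A := by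
      rw [cfc_sub (fun _ : ℂ => (c : ℂ)) (fun z : ℂ => z) A, cfc_const (c : ℂ) A, cfc_id' ℂ A]
    have e2 : (fun z : ℂ => g (c - z.re)) = fun z : ℂ => g ((c : ℂ) - z).re := by
      ext z; simp
    calc cfcC A' g = cfc (fun z : ℂ => g z.re) (cfc (fun z : ℂ => (c : ℂ) - z) A) := by
          rw [cfcC_def, hA'eq, e1]
      _ = cfc (fun z : ℂ => g ((c : ℂ) - z).re) A :=
          (cfc_comp' (fun z : ℂ => g z.re) (fun z : ℂ => (c : ℂ) - z) A).symm
      _ = cfcC A (fun t => g (c - t)) := by rw [cfcC_def, e2]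
  ext ψ
  set ν := specMeasure A' hA' ψ + (specMeasure A hA ψ).map (fun t : ℝ => c - t)
  obtain ⟨g, hgc, hgb, hg⟩ := exists_seq_continuous_tendsto_integral ν hf hC
  have h1 := tendsto_cfcC_borelCFC_of_le hA' hf hC ψ (Measure.le_add_right le_rfl) hgc hgb hg
  have hmeas : Measurable fun t : ℝ => c - t := measurable_const.sub measurable_id
  have hf' : Measurable fun t => f (c - t) := hf.comp hmeas
  have hC' : ∀ t, ‖f (c - t)‖ ≤ C := fun t => hC _
  have hg2 : Tendsto (fun n => ∫ t, ‖f (c - t) - g n (c - t)‖ ∂(specMeasure A hA ψ)) atTop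
      (𝓝 0) := by
    have hle : (specMeasure A hA ψ).map (fun t : ℝ => c - t) ≤ ν := Measure.le_add_left le_rfl
    have h3 := tendsto_integral_norm_sub_mono hle hf hC hgc hgb hg
    refine h3.congr fun n => ?_
    rw [integral_map hmeas.aemeasurable]
    exact ((hf.sub (hgc n).measurable).norm).aestronglyMeasurable
  have h2 := tendsto_cfcC_borelCFC hA hf' hC' ψ (g := fun n t => g n (c - t))
    (fun n => (hgc n).comp (continuous_const.sub continuous_id)) (fun n t => hgb n _) hg2
  have heq : (fun n => cfcC A' (g n) ψ) = fun n => cfcC A (fun t => g n (c - t)) ψ := by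
    ext n; rw [hcont (hgc n)]
  rw [heq] at h1
  exact tendsto_nhds_unique h1 h2

end Intertwine

/-! ### Locality off a non-eigenvalue -/

section Point

variable {A : H →L[ℂ] H} (hA : IsSelfAdjoint A)

/-- **Locality off a non-eigenvalue**: if `A − a` is injective (i.e. `a` is not an eigenvalue of
`A`) and the bounded Borel functions `f`, `f'` agree on the spectrum except possibly at `a`, then
`f(A) = f'(A)` — the spectral measures do not charge `a` (`specMeasure_singleton_eq_zero`).
Rieffel–van Daele §3, p. 194: "both `R` and `2 − R` are injective … the spectral measures for `R`
and `2 − R` are both concentrated on the open interval `(0, 2)`".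
[cite: RieffelVandaele1977, §3 p. 194] -/
theorem borelCFC_congr_off_point {a : ℝ}
    (hinj : Function.Injective (A - (a : ℂ) • (1 : H →L[ℂ] H)))
    {f f' : ℝ → ℂ} (hf : Measurable f) (hf' : Measurable f') {C C' : ℝ}
    (hC : ∀ t, ‖f t‖ ≤ C) (hC' : ∀ t, ‖f' t‖ ≤ C')
    (h : Set.EqOn f f' (spectrum ℝ A \ {a})) :
    borelCFC A hA f = borelCFC A hA f' := by
  ext ψ
  refine borelCFC_apply_eq_of_ae_eq hA hf hf' hC hC' ψ ?_
  filter_upwards [ae_mem_spectrum hA ψ, ae_ne_of_injective hA a hinj ψ] with t ht hta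
  exact h ⟨ht, hta⟩

/-- Locality off two non-eigenvalues (for Rieffel–van Daele's `R` at `0` and `2`).
[cite: RieffelVandaele1977, §3 p. 194] -/
theorem borelCFC_congr_off_two_points {a b : ℝ}
    (ha : Function.Injective (A - (a : ℂ) • (1 : H →L[ℂ] H)))
    (hb : Function.Injective (A - (b : ℂ) • (1 : H →L[ℂ] H)))
    {f f' : ℝ → ℂ} (hf : Measurable f) (hf' : Measurable f') {C C' : ℝ}
    (hC : ∀ t, ‖f t‖ ≤ C) (hC' : ∀ t, ‖f' t‖ ≤ C')
    (h : Set.EqOn f f' (spectrum ℝ A \ {a, b})) :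
    borelCFC A hA f = borelCFC A hA f' := by
  ext ψ
  refine borelCFC_apply_eq_of_ae_eq hA hf hf' hC hC' ψ ?_
  filter_upwards [ae_mem_spectrum hA ψ, ae_ne_of_injective hA a ha ψ,
    ae_ne_of_injective hA b hb ψ] with t ht hta htb
  exact h ⟨ht, by simp [hta, htb]⟩

end Point

end Literature.Analysis.OperatorTheory
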